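import Summits.QuantumFields.YangMills.Theorems.LuscherReductionDressedRitzLiftLeakageResidual
import Summits.QuantumFields.YangMills.Theorems.LuscherReductionDressedRitzPolyakovLiftDefs
import Summits.QuantumFields.YangMills.Theorems.FemtoTransferGapSlabGround
import HarnessLib

/-!
# Crux `DressedRitz` (stmt-QuantumFields-20205), line «polyakovlift», stub S-POS `stub_liftPosition` — support II:
# the POLARISED Dirichlet identity and the Dirichlet currency of the coupling clause (o6)

Support module (LEAD prover ym-lead-20205-polyakovlift g0; `--supports stmt-QuantumFields-20205`, helper, no closure claim) for the registered
load-bearing stub `…Cruxes.DressedRitz.PolyakovLift.stub_liftPosition` (skeleton r2 62fcf7b4f9c136d2): time-1 CORE clauses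
`PolyakovLift.DynamicCoreClauses` = (o5) Lüscher position ∧ (o6) symmetrised couplings.  Companion of support I (`…LiftPositionDirichlet.lean`,
diagonal identity).

THE POLARISED IDENTITY (fixed lattice, no RG).  For a raw vacuum `φ` (`‖φ‖ = 1`, `K_βφ = λ₀φ`) and physical insertions `O₁, O₂`, with
`u_a = ins φ O_a`, `n₁₂ = ⟨u₁,u₂⟩`, `d₁₂ = ⟨u₁, K_β u₂⟩`:

  `λ₀·n₁₂ − d₁₂ = ½ ∬ (O₁(U) − O₁(V))(O₂(U) − O₂(V)) φ(U) K_β(U,V) φ(V) dU dV =: D₁₂`     (`dirichlet_cross_identity`)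

— the vacuum constants cancel (`cross_normSq`, `cross_form`: `n₁₂ = ⟨O₁φ,O₂φ⟩ − c₁c₂`, `d₁₂ = ⟨O₁φ,K_β(O₂φ)⟩ − λ₀c₁c₂`), and the QUADRATIC
CO-VARIATION of the two observables over one transfer step appears.  With `E_a := D_aa/n_aa` (the effective energies, `= λ₀ − d_aa/n_aa`) the
coupling clause (o6) `|d₁₂ − ½(d₁₁/n₁₁ + d₂₂/n₂₂)n₁₂| ≤ C(λ²/L)λ₀√n₁₁√n₂₂` reads, IDENTICALLY (`coupling_defect_eq`),

  `|D₁₂ − ½(E₁ + E₂)·n₁₂| ≤ C(λ²/L)λ₀√n₁₁√n₂₂`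

— the `k × k` quadratic-variation matrix `D` of the flowed Polyakov eigen-ratios under the fine two-slice vacuum law is DIAGONALISED by the lift
basis up to `O(λ²/L)λ₀`, relative to the Gram matrix (in the one-site model, `φ = e₀`, `O_a = e_{j_a}/e₀`: `D = diag(μ₀ − μ_{j_a})`, `n = 1`,
defect `0` exactly).  Together with support I: the whole core stub S-POS is a statement about the pair (Gram matrix `n`, quadratic-variation
matrix `D`) of the explicit insertions — the natural currency of a renormalisation-group ∕ Born–Oppenheimer proof.

* `cross_normSq`, `cross_form` — polarised time-0 ∕ time-1 correlator currency (tree `LiftLeak.ins_normSq ∕ ins_form` are the diagonal cases);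
* `inner_increment_cross`, `increment_cross_eq` — expansion of the two-slice expectation of the product of increments;
* ★ `dirichlet_cross_identity`;  `coupling_defect_eq` ∕ ★ `coreO6_of_dirichlet` — (o6) conjunct of `DynamicCoreClauses` VERBATIM from the
  Dirichlet-currency bound.

HONEST FRAMING: fixed-lattice bookkeeping on the conditional femto rung R2b1; the stub `stub_liftPosition` stays OPEN; nothing here bears on
infinite volume, the continuum limit or the Clay gap.  References: M. Lüscher, U. Wolff, NPB 339 (1990) 222 [cite: LuscherWolff1990];
E. Seiler, LNP 159 [cite: SeilerLNP1982, §3]; M. Lüscher, NPB 219 (1983) 233 [cite: Luscher1983, §3].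
-/

set_option autoImplicit false

noncomputable section

open MeasureTheory Filter Topology Real
open Literature.MathematicalPhysics.QuantumFieldTheory
open Literature.MathematicalPhysics.QuantumLattice
open scoped BigOperators

namespace Summit.QuantumFields.YangMills.Theorems.FemtoTransferGap.LiftPos

open Summit.QuantumFields.YangMills.Theorems.FemtoTransferGap
open Summit.QuantumFields.YangMills.Theorems.FemtoTransferGap.OpPlat

section Femto

variable {L : ℕ} [NeZero L]

/-! ## §1 Polarised correlator currency -/

/-- **Polarised time-0 currency**: `⟨ins φ O₁, ins φ O₂⟩ = ⟨O₁φ, O₂φ⟩ − c₁c₂`, `c_a = ⟨φ, O_aφ⟩`, `‖φ‖ = 1`. [cite: LuscherWolff1990] -/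
theorem cross_normSq {φ O₁ O₂ : GaugeConfig 3 L SU2 → ℝ} (hφ : IsPhys φ) (hO₁ : IsPhys O₁) (hO₂ : IsPhys O₂) (hφ1 : l2 φ φ = 1) :
    l2 (ins φ O₁) (ins φ O₂) = l2 (O₁ * φ) (O₂ * φ) - l2 φ (O₁ * φ) * l2 φ (O₂ * φ) := by
  set Φ : physSubmodule L := ⟨φ, hφ⟩ with hΦ
  set P₁ : physSubmodule L := ⟨O₁ * φ, isPhys_mul hO₁ hφ⟩ with hP₁
  set P₂ : physSubmodule L := ⟨O₂ * φ, isPhys_mul hO₂ hφ⟩ with hP₂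
  have hins₁ : ins φ O₁ = ((P₁ - l2 φ (O₁ * φ) • Φ : physSubmodule L) : GaugeConfig 3 L SU2 → ℝ) := by rw [ins_eq]; rfl
  have hins₂ : ins φ O₂ = ((P₂ - l2 φ (O₂ * φ) • Φ : physSubmodule L) : GaugeConfig 3 L SU2 → ℝ) := by rw [ins_eq]; rfl
  have hc₁ : l2Form L P₁ Φ = l2 φ (O₁ * φ) := by rw [l2Form_apply, l2_comm]
  have hc₂ : l2Form L Φ P₂ = l2 φ (O₂ * φ) := by rw [l2Form_apply]
  have h1 : l2Form L Φ Φ = 1 := by simpa [l2Form_apply] using hφ1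
  have h : l2Form L (P₁ - l2 φ (O₁ * φ) • Φ) (P₂ - l2 φ (O₂ * φ) • Φ) = l2Form L P₁ P₂ - l2 φ (O₁ * φ) * l2 φ (O₂ * φ) := by
    simp only [map_sub, map_smul, LinearMap.sub_apply, LinearMap.smul_apply, smul_eq_mul, hc₁, hc₂, h1]
    ring
  rw [hins₁, hins₂, ← l2Form_apply, h, l2Form_apply]

/-- **Polarised time-1 currency**: with `K_βφ = λ₀φ`, `⟨ins φ O₁, K_β(ins φ O₂)⟩ = ⟨O₁φ, K_β(O₂φ)⟩ − λ₀c₁c₂`. [cite: LuscherWolff1990] -/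
theorem cross_form (β : ℝ) {φ O₁ O₂ : GaugeConfig 3 L SU2 → ℝ} (hφ : IsPhys φ) (hO₁ : IsPhys O₁) (hO₂ : IsPhys O₂) (hφ1 : l2 φ φ = 1)
    (heig : transferApply β φ = levelValue su2Rep L β 0 • φ) :
    l2 (ins φ O₁) (transferApply β (ins φ O₂)) =
      l2 (O₁ * φ) (transferApply β (O₂ * φ)) - levelValue su2Rep L β 0 * (l2 φ (O₁ * φ) * l2 φ (O₂ * φ)) := by
  set Φ : physSubmodule L := ⟨φ, hφ⟩ with hΦ
  set P₁ : physSubmodule L := ⟨O₁ * φ, isPhys_mul hO₁ hφ⟩ with hP₁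
  set P₂ : physSubmodule L := ⟨O₂ * φ, isPhys_mul hO₂ hφ⟩ with hP₂
  have hins₁ : ins φ O₁ = ((P₁ - l2 φ (O₁ * φ) • Φ : physSubmodule L) : GaugeConfig 3 L SU2 → ℝ) := by rw [ins_eq]; rfl
  have hins₂ : ins φ O₂ = ((P₂ - l2 φ (O₂ * φ) • Φ : physSubmodule L) : GaugeConfig 3 L SU2 → ℝ) := by rw [ins_eq]; rfl
  have hK : transferOp β Φ = levelValue su2Rep L β 0 • Φ := Subtype.ext (by simpa [coe_transferOp] using heig)
  have hc₁ : l2Form L P₁ Φ = l2 φ (O₁ * φ) := by rw [l2Form_apply, l2_comm]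
  have hc₂ : l2Form L Φ P₂ = l2 φ (O₂ * φ) := by rw [l2Form_apply]
  have h1 : l2Form L Φ Φ = 1 := by simpa [l2Form_apply] using hφ1
  have hΦK : l2Form L Φ (transferOp β P₂) = levelValue su2Rep L β 0 * l2 φ (O₂ * φ) := by
    rw [← transferOp_symm, hK, map_smul, LinearMap.smul_apply, smul_eq_mul, hc₂]
  have h : l2Form L (P₁ - l2 φ (O₁ * φ) • Φ) (transferOp β (P₂ - l2 φ (O₂ * φ) • Φ)) =
      l2Form L P₁ (transferOp β P₂) - levelValue su2Rep L β 0 * (l2 φ (O₁ * φ) * l2 φ (O₂ * φ)) := by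
    simp only [map_sub, map_smul, LinearMap.sub_apply, LinearMap.smul_apply, smul_eq_mul, hK, hΦK, hc₁, h1]
    ring
  have hcoe : transferApply β (ins φ O₂) = ((transferOp β (P₂ - l2 φ (O₂ * φ) • Φ) : physSubmodule L) : GaugeConfig 3 L SU2 → ℝ) := by
    rw [hins₂, coe_transferOp]
  rw [hcoe, hins₁, ← l2Form_apply, h, l2Form_apply, coe_transferOp]

/-! ## §2 The two-slice expectation of the product of increments -/

/-- Inner integral of the product of increments: for fixed `U`,
`∫ (O₁U − O₁V)(O₂U − O₂V) φ(U)K_β(U,V)φ(V) dV = (O₁O₂φ·K_βφ)(U) − (O₁φ·K_β(O₂φ))(U) − (O₂φ·K_β(O₁φ))(U) + (φ·K_β(O₁O₂φ))(U)`. [folklore] -/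
theorem inner_increment_cross (β : ℝ) {φ O₁ O₂ : GaugeConfig 3 L SU2 → ℝ} (hφ : IsPhys φ) (hO₁ : IsPhys O₁) (hO₂ : IsPhys O₂)
    (U : GaugeConfig 3 L SU2) :
    ∫ V, (O₁ U - O₁ V) * (O₂ U - O₂ V) * (φ U * transferKernel su2Rep β U V * φ V) ∂(configMeasure SU2 L) =
      ((O₁ * O₂ * φ) * transferApply β φ) U - ((O₁ * φ) * transferApply β (O₂ * φ)) U
        - ((O₂ * φ) * transferApply β (O₁ * φ)) U + (φ * transferApply β (O₁ * O₂ * φ)) U := by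
  have hO₁φ : IsPhys (O₁ * φ) := isPhys_mul hO₁ hφ
  have hO₂φ : IsPhys (O₂ * φ) := isPhys_mul hO₂ hφ
  have h12φ : IsPhys (O₁ * O₂ * φ) := isPhys_mul (isPhys_mul hO₁ hO₂) hφ
  obtain ⟨C₀, hC₀⟩ := hφ.bounded
  obtain ⟨C₁, hC₁⟩ := hO₁φ.bounded
  obtain ⟨C₂, hC₂⟩ := hO₂φ.bounded
  obtain ⟨C₃, hC₃⟩ := h12φ.bounded
  have i₀ := integrable_transferKernel_mul β U hφ.measurable hC₀
  have i₁ := integrable_transferKernel_mul β U hO₁φ.measurable hC₁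
  have i₂ := integrable_transferKernel_mul β U hO₂φ.measurable hC₂
  have i₃ := integrable_transferKernel_mul β U h12φ.measurable hC₃
  have hpt : ∀ V, (O₁ U - O₁ V) * (O₂ U - O₂ V) * (φ U * transferKernel su2Rep β U V * φ V) =
      (O₁ U * O₂ U * φ U) * (transferKernel su2Rep β U V * φ V) - (O₁ U * φ U) * (transferKernel su2Rep β U V * (O₂ * φ) V)
        - (O₂ U * φ U) * (transferKernel su2Rep β U V * (O₁ * φ) V) + φ U * (transferKernel su2Rep β U V * (O₁ * O₂ * φ) V) :=
    fun V => by simp only [Pi.mul_apply]; ring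
  simp_rw [hpt]
  have iA : Integrable (fun V => O₁ U * O₂ U * φ U * (transferKernel su2Rep β U V * φ V)) (configMeasure SU2 L) := i₀.const_mul _
  have iB : Integrable (fun V => O₁ U * φ U * (transferKernel su2Rep β U V * (O₂ * φ) V)) (configMeasure SU2 L) := i₂.const_mul _
  have iC : Integrable (fun V => O₂ U * φ U * (transferKernel su2Rep β U V * (O₁ * φ) V)) (configMeasure SU2 L) := i₁.const_mul _
  have iD : Integrable (fun V => φ U * (transferKernel su2Rep β U V * (O₁ * O₂ * φ) V)) (configMeasure SU2 L) := i₃.const_mul _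
  have iAB : Integrable (fun V => O₁ U * O₂ U * φ U * (transferKernel su2Rep β U V * φ V)
      - O₁ U * φ U * (transferKernel su2Rep β U V * (O₂ * φ) V)) (configMeasure SU2 L) := iA.sub iB
  have iABC : Integrable (fun V => O₁ U * O₂ U * φ U * (transferKernel su2Rep β U V * φ V)
      - O₁ U * φ U * (transferKernel su2Rep β U V * (O₂ * φ) V)
      - O₂ U * φ U * (transferKernel su2Rep β U V * (O₁ * φ) V)) (configMeasure SU2 L) := iAB.sub iC
  rw [integral_add iABC iD, integral_sub iAB iC, integral_sub iA iB, integral_const_mul, integral_const_mul, integral_const_mul,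
    integral_const_mul]
  simp only [Pi.mul_apply, transferApply_apply]

/-- **`½∬(ΔO₁)(ΔO₂) φK_βφ = λ₀⟨O₁φ, O₂φ⟩ − ⟨O₁φ, K_β(O₂φ)⟩`** for a physical top eigenvector `φ` and physical `O₁, O₂` (expand; eigen-equation on
the two pure terms, symmetry of `K_β` on the two mixed ones). [cite: SeilerLNP1982, §3] -/
theorem increment_cross_eq (β : ℝ) {φ O₁ O₂ : GaugeConfig 3 L SU2 → ℝ} (hφ : IsPhys φ) (hO₁ : IsPhys O₁) (hO₂ : IsPhys O₂)
    (heig : transferApply β φ = levelValue su2Rep L β 0 • φ) :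
    (1 / 2 : ℝ) * ∫ U, ∫ V, (O₁ U - O₁ V) * (O₂ U - O₂ V) * (φ U * transferKernel su2Rep β U V * φ V)
        ∂(configMeasure SU2 L) ∂(configMeasure SU2 L) =
      levelValue su2Rep L β 0 * l2 (O₁ * φ) (O₂ * φ) - l2 (O₁ * φ) (transferApply β (O₂ * φ)) := by
  have hO₁φ : IsPhys (O₁ * φ) := isPhys_mul hO₁ hφ
  have hO₂φ : IsPhys (O₂ * φ) := isPhys_mul hO₂ hφ
  have h12φ : IsPhys (O₁ * O₂ * φ) := isPhys_mul (isPhys_mul hO₁ hO₂) hφ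
  simp_rw [inner_increment_cross β hφ hO₁ hO₂]
  have jA : Integrable (fun U => ((O₁ * O₂ * φ) * transferApply β φ) U) (configMeasure SU2 L) :=
    (isPhys_mul h12φ (isPhys_transferApply β hφ)).integrable
  have jB : Integrable (fun U => ((O₁ * φ) * transferApply β (O₂ * φ)) U) (configMeasure SU2 L) :=
    (isPhys_mul hO₁φ (isPhys_transferApply β hO₂φ)).integrable
  have jC : Integrable (fun U => ((O₂ * φ) * transferApply β (O₁ * φ)) U) (configMeasure SU2 L) :=
    (isPhys_mul hO₂φ (isPhys_transferApply β hO₁φ)).integrable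
  have jD : Integrable (fun U => (φ * transferApply β (O₁ * O₂ * φ)) U) (configMeasure SU2 L) :=
    (isPhys_mul hφ (isPhys_transferApply β h12φ)).integrable
  have jAB : Integrable (fun U => ((O₁ * O₂ * φ) * transferApply β φ) U - ((O₁ * φ) * transferApply β (O₂ * φ)) U)
      (configMeasure SU2 L) := jA.sub jB
  have jABC : Integrable (fun U => ((O₁ * O₂ * φ) * transferApply β φ) U - ((O₁ * φ) * transferApply β (O₂ * φ)) U
      - ((O₂ * φ) * transferApply β (O₁ * φ)) U) (configMeasure SU2 L) := jAB.sub jC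
  rw [integral_add jABC jD, integral_sub jAB jC, integral_sub jA jB]
  have eA : ∫ U, ((O₁ * O₂ * φ) * transferApply β φ) U ∂(configMeasure SU2 L) = levelValue su2Rep L β 0 * l2 (O₁ * φ) (O₂ * φ) := by
    rw [heig]
    have : (fun U => ((O₁ * O₂ * φ) * (levelValue su2Rep L β 0 • φ)) U) =
        fun U => levelValue su2Rep L β 0 * ((O₁ * φ) U * (O₂ * φ) U) := by
      funext U; simp only [Pi.mul_apply, Pi.smul_apply, smul_eq_mul]; ring
    rw [this, integral_const_mul]; rfl
  have eB : ∫ U, ((O₁ * φ) * transferApply β (O₂ * φ)) U ∂(configMeasure SU2 L) = l2 (O₁ * φ) (transferApply β (O₂ * φ)) := rfl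
  have eC : ∫ U, ((O₂ * φ) * transferApply β (O₁ * φ)) U ∂(configMeasure SU2 L) = l2 (O₁ * φ) (transferApply β (O₂ * φ)) := by
    have h1 : ∫ U, ((O₂ * φ) * transferApply β (O₁ * φ)) U ∂(configMeasure SU2 L) = l2 (O₂ * φ) (transferApply β (O₁ * φ)) := rfl
    rw [h1, ← l2_transferApply_comm β hO₁φ hO₂φ, l2_comm]
  have eD : ∫ U, (φ * transferApply β (O₁ * O₂ * φ)) U ∂(configMeasure SU2 L) = levelValue su2Rep L β 0 * l2 (O₁ * φ) (O₂ * φ) := by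
    have h1 : ∫ U, (φ * transferApply β (O₁ * O₂ * φ)) U ∂(configMeasure SU2 L) = l2 φ (transferApply β (O₁ * O₂ * φ)) := rfl
    rw [h1, ← l2_transferApply_comm β hφ h12φ, heig]
    have : (fun U => (levelValue su2Rep L β 0 • φ) U * (O₁ * O₂ * φ) U) =
        fun U => levelValue su2Rep L β 0 * ((O₁ * φ) U * (O₂ * φ) U) := by
      funext U; simp only [Pi.mul_apply, Pi.smul_apply, smul_eq_mul]; ring
    unfold l2; rw [this, integral_const_mul]
  rw [eA, eB, eC, eD]; ring

/-! ## §3 ★ The polarised Dirichlet identity and the coupling clause (o6) in Dirichlet currency -/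

/-- ★ **POLARISED DIRICHLET IDENTITY**: for a raw vacuum `φ` and physical insertions `O₁, O₂`, the channel vectors `u_a = ins φ O_a` satisfy
`λ₀⟨u₁,u₂⟩ − ⟨u₁, K_βu₂⟩ = ½∬(O₁(U) − O₁(V))(O₂(U) − O₂(V)) φ(U)K_β(U,V)φ(V)`. [cite: LuscherWolff1990] [cite: SeilerLNP1982, §3] -/
theorem dirichlet_cross_identity (β : ℝ) {φ O₁ O₂ : GaugeConfig 3 L SU2 → ℝ} (hφ : IsPhys φ) (hO₁ : IsPhys O₁) (hO₂ : IsPhys O₂)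
    (hφ1 : l2 φ φ = 1) (heig : transferApply β φ = levelValue su2Rep L β 0 • φ) :
    levelValue su2Rep L β 0 * l2 (ins φ O₁) (ins φ O₂) - l2 (ins φ O₁) (transferApply β (ins φ O₂)) =
      (1 / 2 : ℝ) * ∫ U, ∫ V, (O₁ U - O₁ V) * (O₂ U - O₂ V) * (φ U * transferKernel su2Rep β U V * φ V)
        ∂(configMeasure SU2 L) ∂(configMeasure SU2 L) := by
  rw [increment_cross_eq β hφ hO₁ hO₂ heig, cross_normSq hφ hO₁ hO₂ hφ1, cross_form β hφ hO₁ hO₂ hφ1 heig]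
  ring

/-- **The coupling defect in Dirichlet currency** (pure algebra): with `D_ab := λ₀ n_ab − d_ab` and `n_aa ≠ 0`,
`d₁₂ − ½(d₁₁/n₁₁ + d₂₂/n₂₂)·n₁₂ = −(D₁₂ − ½(D₁₁/n₁₁ + D₂₂/n₂₂)·n₁₂)`. [folklore] -/
theorem coupling_defect_eq {l0 n11 n22 n12 d11 d22 d12 : ℝ} (h1 : n11 ≠ 0) (h2 : n22 ≠ 0) :
    d12 - (d11 / n11 + d22 / n22) / 2 * n12 =
      -((l0 * n12 - d12) - ((l0 * n11 - d11) / n11 + (l0 * n22 - d22) / n22) / 2 * n12) := by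
  field_simp
  ring

/-- ★ **The (o6) conjunct of `PolyakovLift.DynamicCoreClauses k C β u`, VERBATIM, from the Dirichlet-currency bound**: if the norms are positive and
`|D_il − ½(D_ii/n_ii + D_ll/n_ll) n_il| ≤ C(λ²/L)λ₀√n_ii√n_ll` for `i ≠ l` (`D_ab = λ₀⟨u_a,u_b⟩ − ⟨u_a,K_βu_b⟩`, the quadratic co-variation of
support I ∕ `dirichlet_cross_identity`), then (o6) holds. [cite: Luscher1983, §3] -/
theorem coreO6_of_dirichlet {k : ℕ} (C β : ℝ) {u : Fin k → (GaugeConfig 3 L SU2 → ℝ)}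
    (h0 : ∀ i : Fin k, 0 < l2 (u i) (u i))
    (hD : ∀ i l : Fin k, i ≠ l →
      |(levelValue su2Rep L β 0 * l2 (u i) (u l) - l2 (u i) (transferApply β (u l))) -
          ((levelValue su2Rep L β 0 * l2 (u i) (u i) - l2 (u i) (transferApply β (u i))) / l2 (u i) (u i) +
            (levelValue su2Rep L β 0 * l2 (u l) (u l) - l2 (u l) (transferApply β (u l))) / l2 (u l) (u l)) / 2 * l2 (u i) (u l)|
        ≤ C * (luscherLambda β L ^ 2 / L) * levelValue su2Rep L β 0 * (Real.sqrt (l2 (u i) (u i)) * Real.sqrt (l2 (u l) (u l)))) :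
    ∀ i l : Fin k, i ≠ l →
      |l2 (u i) (transferApply β (u l)) -
          (l2 (u i) (transferApply β (u i)) / l2 (u i) (u i) + l2 (u l) (transferApply β (u l)) / l2 (u l) (u l)) / 2 *
            l2 (u i) (u l)|
        ≤ C * (luscherLambda β L ^ 2 / L) * levelValue su2Rep L β 0 * (Real.sqrt (l2 (u i) (u i)) * Real.sqrt (l2 (u l) (u l))) := by
  intro i l hil
  rw [coupling_defect_eq (l0 := levelValue su2Rep L β 0) (h0 i).ne' (h0 l).ne', abs_neg]
  exact hD i l hil

end Femto

end Summit.QuantumFields.YangMills.Theorems.FemtoTransferGap.LiftPos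

end
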